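import Literature.Topology.FourManifolds.CorkDecompositionMatveyevForm
import Literature.Topology.FourManifolds.MorseRearrangementHolds
import Literature.Topology.FourManifolds.HCobordismMiddleStepProofs
import Literature.Topology.FourManifolds.SmoothOrientationProofs
import Literature.Topology.FourManifolds.SPC4HandleChainProofs
import HarnessLib

/-!
# The middle level of a two-three handlebody: the proved front of rung (B) of the cork DAG

Topic `Literature/Topology/FourManifolds` (fact seat
`provefact-Literature.Topology.FourManifolds.corkDecomposition`; companion of
`CorkDecompositionMiddleLevel.lean`).  The cork decomposition theorem
`Literature.Topology.FourManifolds.corkDecomposition` is reduced in the tree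
(`corkDecomposition_of_eightOne_middleLevel`, `CorkDecompositionMatveyevForm.lean`) to Milnor's
Thm. 8.1 at one end, the passage to the middle level **(B)**
`Literature.Topology.FourManifolds.exists_dualSpheres_middleLevel_of_two_three`, and the
four-dimensional construction **(H4)**.  This file proves outright the part of (B) that the
tree's Morse-theoretic infrastructure now supports, in the form the eventual proof of (B)
consumes, following the first sentences of the printed proofs:

> Matveyev 1996 (arXiv:dg-ga/9505001), Proof of Theorem, p. 1: *"`U` has a handlebody with no
> 1- and 4-handles.  Let `N` be the middle level of `U` between 2- and 3-handles."*
> Kirby 1996 (arXiv:math/9712231), §2: *"there exists a Morse function `f : M⁵ → [0, 1]` with no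
> critical points of index 0, 1, 4 or 5 […].  We can assume that `M_{1/2} = f⁻¹(1/2)` has all
> the 2-handles below and all the 3-handles above.  Note that `M_{1/2}` is 1-connected
> (5-manifolds with only 3, 4 and 5-handles are 1-connected)."*
> Milnor 1965, §3, p. 21 (PDF p. 21): *"Let us choose a vector field `ξ` [...]"*; and Thm. 4.8
> with its proof (PDF p. 25), which puts all critical points of one index on one level; Remark 1
> after Thm. 6.4 (PDF p. 38): *"`V = f⁻¹(1/2)` is also simply connected"*; proof of Cor. 6.5
> (PDF p. 38): *"`W` is simply connected hence orientable.  So `V` is orientable"*.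

## Contents (all proved; no statement is introduced)

* `Literature.Topology.FourManifolds.Cobordism.IsMorseFunction.apply_mem_Ioo_of_rearrangement` —
  **a rearrangement inside the slab `f⁻¹(a, b)` keeps the values of the slab in `(a, b)`**: if
  `g` is a Morse function on the cobordism equal to `f` off `f⁻¹(a, b)` and the critical
  points of `g` inside `f⁻¹(a, b)` have `g`-values in `(a, b)`, then `g(f⁻¹(a, b)) ⊆ (a, b)`
  (maximum principle: an interior extremum is a critical point).  This is implicit in Milnor's
  construction of 4.1 (`g = G(f, μ)` with `∂G/∂x > 0`, PDF p. 22) but not recorded in the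
  tree's statement of the rearrangement; it is what makes the level sets off the slab, in
  particular the middle level, literally unchanged.
* `Literature.Topology.FourManifolds.Cobordism.IsMorseFunction.exists_sameCritical_oneLevel_window` —
  **all critical points of a window `f⁻¹(a, b)` carrying one index put on one level**, by a
  Morse function with the same critical points and indices, equal to `f` off `f⁻¹(a, b)` and
  mapping `f⁻¹(a, b)` into `(a, b)` (induction on the number of critical levels in the window,
  merging the two lowest ones by the tree's theorem
  `Cobordism.Milnor1965_rearrange_consecutive_levels_holds` (`MorseRearrangementHolds.lean`:
  Thms. 4.1–4.2 with 4.4 on a slab) with `a' = b'`; Milnor's proof of Thm. 4.8, PDF p. 25, run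
  inside the window).
* `Literature.Topology.FourManifolds.Cobordism.IsMorseFunction.exists_two_three_oneLevel` — for a
  two-three Morse function (index `2` below `1/2`, index `3` above): the same with all index-`2`
  points on one level `v₂ < 1/2` and all index-`3` points on one level `v₃ > 1/2`, the new
  function agreeing with `f` on a neighbourhood `f⁻¹(1/2 - δ, 1/2 + δ)` of the middle level.
* `Literature.Topology.FourManifolds.Cobordism.IsHCobordism.simplyConnectedSpace_middleLevel_of_two_three`
  and `Literature.Topology.FourManifolds.Cobordism.IsHCobordism.exists_oriented_middleLevel_of_two_three` —
  **the middle level `f⁻¹(1/2)` of a two-three Morse function on an h-cobordism between simply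
  connected closed 4-manifolds is presented by a closed, simply connected, oriented smooth
  4-manifold** smoothly embedded onto `f⁻¹(1/2)` (regular value theorem `RegularLevel`;
  `Cobordism.Milnor1965_simplyConnected_levels_holds`, clause (1), Milnor's Remark 1 after
  Thm. 6.4; `isOrientable_of_simplyConnectedSpace_holds`, proof of Cor. 6.5) — exactly the
  data `N`, `oN`, `ι` in the conclusion of (B).

What remains of (B) after this file is recorded in its docstring: the surgery description of
the two ends (Milnor Thm. 3.13 read through the two critical levels) and the duality of the
two sphere families after handle slides (Thm. 7.6 with Cor. 7.3 and Thm. 7.4).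

## References

* R. Matveyev, *A decomposition of smooth simply-connected h-cobordant 4-manifolds*,
  J. Differential Geom. 44 (1996) 571–582; arXiv:dg-ga/9505001, Proof of Theorem, p. 1.
  [Matveyev1996]
* R. Kirby, *Akbulut's corks and h-cobordisms of smooth, simply connected 4-manifolds*, Turkish
  J. Math. 20 (1996) 85–93; arXiv:math/9712231, §2. [KirbyCorks1996]
* J. Milnor, *Lectures on the h-cobordism theorem*, Princeton (1965): Def. 2.3, Thms. 4.1, 4.2,
  4.4, 4.8 (PDF pp. 22–25), Remark 1 after Thm. 6.4 and proof of Cor. 6.5 (PDF p. 38).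
  [MilnorHCobordism1965]
-/

open scoped Manifold ContDiff Topology
open Set Function Filter

noncomputable section

namespace Literature.Topology.FourManifolds

universe u

namespace Cobordism.IsMorseFunction

/-! ### Values inside a slab are kept by a rearrangement supported in the slab -/

section Values

variable {n : ℕ} {M N : Type u} [TopologicalSpace M] [ChartedSpace (EuclideanSpace ℝ (Fin n)) M]
  [TopologicalSpace N] [ChartedSpace (EuclideanSpace ℝ (Fin n)) N]

/-- **A rearrangement supported in the slab `f⁻¹(a, b)` maps the slab into `(a, b)`**
(maximum principle).  Let `f`, `g` be Morse functions on the cobordism `c`, `0 ≤ a < b ≤ 1`,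
with `g = f` off `f⁻¹(a, b)`, and suppose every critical point of `g` lying in `f⁻¹(a, b)`
has `g`-value in `(a, b)`.  Then `g (f⁻¹(a, b)) ⊆ (a, b)`: on the compact `f⁻¹[a, b]` the
minimum of `g` is either attained where `g = f ∈ {a, b}` or at a point of the open set
`f⁻¹(a, b)`, which is then an interior local minimum of `g`, hence a critical point, whose
value is `> a` by hypothesis; so `g ≥ a` on the slab, and a point of `f⁻¹(a, b)` with `g = a`
would again be an interior local minimum; likewise from above.  (Milnor's rearranged function
`g = G(f, μ)` of Thm. 4.1, PDF p. 22, has this property by construction — `G(·, y)` increases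
from `0` to `1`; the tree's statement `Cobordism.Milnor1965_rearrange_consecutive_levels` does
not record it, and this lemma recovers it from what is recorded.)
[cite: MilnorHCobordism1965, Thm. 4.1 (PDF p. 22)] -/
theorem apply_mem_Ioo_of_rearrangement {c : Cobordism n M N} {f g : c.W → ℝ}
    (hf : c.IsMorseFunction f) (hg : c.IsMorseFunction g) {a b : ℝ} (ha : 0 ≤ a) (hb : b ≤ 1)
    (heq : ∀ z, f z ∉ Ioo a b → g z = f z)
    (hcrit : ∀ z ∈ criticalSet (𝓡∂ (n + 1)) g, f z ∈ Ioo a b → g z ∈ Ioo a b) :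
    ∀ z, f z ∈ Ioo a b → g z ∈ Ioo a b := by
  have hfc : Continuous f := hf.isMorse.contMDiff.continuous
  have hgc : Continuous g := hg.isMorse.contMDiff.continuous
  have hU : IsOpen (f ⁻¹' Ioo a b) := isOpen_Ioo.preimage hfc
  have hK : IsCompact (f ⁻¹' Icc a b) := (isClosed_Icc.preimage hfc).isCompact
  -- an interior local extremum of `g` inside the open slab is a critical point
  have key_min : ∀ z, f z ∈ Ioo a b → (∀ y, f y ∈ Ioo a b → g z ≤ g y) → g z ∈ Ioo a b := by
    intro z hz hmin
    have hloc : IsLocalMin g z := by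
      filter_upwards [hU.mem_nhds hz] with y hy using hmin y hy
    have hint : (𝓡∂ (n + 1)).IsInteriorPoint z :=
      hf.isInteriorPoint_of_apply_mem_Ioo ⟨ha.trans_lt hz.1, hz.2.trans_le hb⟩
    exact hcrit z (mem_criticalSet.2 (isMCriticalPt_of_isLocalMin hloc hint)) hz
  have key_max : ∀ z, f z ∈ Ioo a b → (∀ y, f y ∈ Ioo a b → g y ≤ g z) → g z ∈ Ioo a b := by
    intro z hz hmax
    have hloc : IsLocalMax g z := by
      filter_upwards [hU.mem_nhds hz] with y hy using hmax y hy
    have hint : (𝓡∂ (n + 1)).IsInteriorPoint z :=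
      hf.isInteriorPoint_of_apply_mem_Ioo ⟨ha.trans_lt hz.1, hz.2.trans_le hb⟩
    exact hcrit z (mem_criticalSet.2 (isMCriticalPt_of_isLocalMax hloc hint)) hz
  intro z₀ hz₀
  have hKne : (f ⁻¹' Icc a b).Nonempty := ⟨z₀, Ioo_subset_Icc_self hz₀⟩
  obtain ⟨m, hmK, hm⟩ := hK.exists_isMinOn hKne hgc.continuousOn
  obtain ⟨m', hm'K, hm'⟩ := hK.exists_isMaxOn hKne hgc.continuousOn
  rw [isMinOn_iff] at hm
  rw [isMaxOn_iff] at hm'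
  -- the minimum of `g` on the closed slab is `≥ a`
  have ham : a ≤ g m := by
    by_cases hmU : f m ∈ Ioo a b
    · exact (key_min m hmU fun y hy => hm y (Ioo_subset_Icc_self hy)).1.le
    · rw [heq m hmU]; exact hmK.1
  -- the maximum of `g` on the closed slab is `≤ b`
  have hbm : g m' ≤ b := by
    by_cases hmU : f m' ∈ Ioo a b
    · exact (key_max m' hmU fun y hy => hm' y (Ioo_subset_Icc_self hy)).2.le
    · rw [heq m' hmU]; exact hm'K.2
  have hlow : a < g z₀ := by
    have hay : a ≤ g z₀ := ham.trans (hm z₀ (Ioo_subset_Icc_self hz₀))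
    rcases hay.lt_or_eq with h | h
    · exact h
    · exact (key_min z₀ hz₀ fun w hw => by
        rw [← h]; exact ham.trans (hm w (Ioo_subset_Icc_self hw))).1
  have hhigh : g z₀ < b := by
    have hyb : g z₀ ≤ b := (hm' z₀ (Ioo_subset_Icc_self hz₀)).trans hbm
    rcases hyb.lt_or_eq with h | h
    · exact h
    · exact (key_max z₀ hz₀ fun w hw => by
        rw [h]; exact (hm' w (Ioo_subset_Icc_self hw)).trans hbm).2
  exact ⟨hlow, hhigh⟩

end Values

/-! ### All critical points of a one-index window on one level -/

section OneLevel

variable {n : ℕ} {M N : Type u} [TopologicalSpace M] [T2Space M] [SecondCountableTopology M]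
  [ChartedSpace (EuclideanSpace ℝ (Fin n)) M] [IsManifold (𝓡 n) ∞ M] [CompactSpace M]
  [TopologicalSpace N] [T2Space N] [SecondCountableTopology N]
  [ChartedSpace (EuclideanSpace ℝ (Fin n)) N] [IsManifold (𝓡 n) ∞ N] [CompactSpace N]

/-- **Merging step** (Milnor 1965, proof of Thm. 4.8, PDF p. 25, inside a window).  Let `f` be
a Morse function on the cobordism `c`, `0 ≤ a < b ≤ 1`, all critical points with value in
the window `(a, b)` of one index `k`, and suppose the window contains at least two critical
levels.  Then there is a Morse function `g` with the same critical points and indices, equal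
to `f` off `f⁻¹(a, b)`, mapping `f⁻¹(a, b)` into `(a, b)`, whose number of critical levels in
the window is smaller: the two lowest critical levels `u < v` of the window are merged by
`Cobordism.Milnor1965_rearrange_consecutive_levels` on a slab `[a₁, b₁] ⊂ (a, b)` isolating them,
with `a' = b' = (u + v)/2`. [cite: MilnorHCobordism1965, Thms. 4.1, 4.2, 4.4 and proof of Thm. 4.8 (PDF pp. 22–25)] -/
theorem exists_sameCritical_merge_window {c : Cobordism n M N} {f : c.W → ℝ}
    (hf : c.IsMorseFunction f) {a b : ℝ} (ha : 0 ≤ a) (hb : b ≤ 1) {k : ℕ}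
    (hk : ∀ z ∈ criticalSet (𝓡∂ (n + 1)) f, f z ∈ Ioo a b → morseIndex (𝓡∂ (n + 1)) f z = k)
    (htwo : 2 ≤ (f '' (criticalSet (𝓡∂ (n + 1)) f ∩ f ⁻¹' Ioo a b)).ncard) :
    ∃ g : c.W → ℝ, c.SameCritical f g ∧ (∀ z, f z ∉ Ioo a b → g z = f z) ∧
      (∀ z, f z ∈ Ioo a b → g z ∈ Ioo a b) ∧
      (g '' (criticalSet (𝓡∂ (n + 1)) g ∩ g ⁻¹' Ioo a b)).ncard <
        (f '' (criticalSet (𝓡∂ (n + 1)) f ∩ f ⁻¹' Ioo a b)).ncard := by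
  classical
  set C := criticalSet (𝓡∂ (n + 1)) f with hC
  have hCfin : C.Finite := hf.finite_criticalSet
  set CV := f '' (C ∩ f ⁻¹' Ioo a b) with hCV
  have hCVfin : CV.Finite := (hCfin.inter_of_left _).image f
  have hCVsub : ∀ t ∈ CV, t ∈ Ioo a b := by
    rintro t ⟨z, ⟨-, hz⟩, rfl⟩; exact hz
  -- the lowest critical level `u` of the window
  have hCVne : CV.Nonempty := by
    by_contra h
    rw [not_nonempty_iff_eq_empty] at h
    rw [h, ncard_empty] at htwo
    exact absurd htwo (by norm_num)
  obtain ⟨u, huCV, hu⟩ := CV.exists_min_image id hCVfin hCVne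
  -- the second lowest critical level `v`
  have hCV'ne : (CV \ {u}).Nonempty := by
    by_contra h
    rw [not_nonempty_iff_eq_empty, sdiff_eq_empty] at h
    have : CV.ncard ≤ 1 := (ncard_le_ncard h (finite_singleton u)).trans (by simp)
    omega
  obtain ⟨v, hvCV', hv⟩ := (CV \ {u}).exists_min_image id hCVfin.sdiff hCV'ne
  have hvCV : v ∈ CV := hvCV'.1
  have hvu : v ≠ u := fun h => hvCV'.2 (by simp [h])
  have huv : u < v := lt_of_le_of_ne (hu v hvCV) (Ne.symm hvu)
  have hua : a < u := (hCVsub u huCV).1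
  have hvb : v < b := (hCVsub v hvCV).2
  -- every critical level of the window other than `u` is `≥ v`
  have hgap : ∀ t ∈ CV, t ≠ u → v ≤ t := fun t ht htu => hv t ⟨ht, by simpa using htu⟩
  -- the upper end `b₀` of the isolating slab: below `b` and below every critical value `> v`
  set R : Set ℝ := insert b {t | t ∈ f '' C ∧ v < t} with hR
  have hRfin : R.Finite := ((hCfin.image f).inter_of_left {t | v < t}).insert b |>.subset (by
    intro t ht
    rcases ht with rfl | ⟨ht1, ht2⟩
    · exact mem_insert _ _
    · exact mem_insert_of_mem _ ⟨ht1, ht2⟩)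
  obtain ⟨b₀, hb₀R, hb₀⟩ := R.exists_min_image id hRfin ⟨b, mem_insert _ _⟩
  have hb₀b : b₀ ≤ b := hb₀ b (mem_insert _ _)
  have hvb₀ : v < b₀ := by
    rcases hb₀R with rfl | ⟨-, h⟩
    · exact hvb
    · exact h
  have hRge : ∀ t ∈ f '' C, v < t → b₀ ≤ t := fun t ht hvt => hb₀ t (mem_insert_of_mem _ ⟨ht, hvt⟩)
  -- the isolating slab `[a₁, b₁]` and the common new level `w`
  set a₁ := (a + u) / 2 with ha₁
  set b₁ := (v + b₀) / 2 with hb₁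
  set w := (u + v) / 2 with hw
  have haa₁ : a < a₁ := by rw [ha₁]; linarith
  have ha₁u : a₁ < u := by rw [ha₁]; linarith
  have hvb₁ : v < b₁ := by rw [hb₁]; linarith
  have hb₁b₀ : b₁ < b₀ := by rw [hb₁]; linarith
  have hb₁b : b₁ < b := lt_of_lt_of_le hb₁b₀ hb₀b
  have ha₁0 : 0 ≤ a₁ := ha.trans haa₁.le
  have hb₁1 : b₁ ≤ 1 := hb₁b.le.trans hb
  have hw₁ : w ∈ Ioo a₁ b₁ := ⟨by rw [hw]; linarith, by rw [hw]; linarith⟩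
  have hslab : Ioo a₁ b₁ ⊆ Ioo a b := Ioo_subset_Ioo haa₁.le hb₁b.le
  have hslab' : Icc a₁ b₁ ⊆ Ioo a b := fun t ht => ⟨haa₁.trans_le ht.1, ht.2.trans_lt hb₁b⟩
  -- the two critical levels to be merged
  set P : Set c.W := {z | z ∈ C ∧ f z = u} with hP
  set Q : Set c.W := {z | z ∈ C ∧ f z = v} with hQ
  have hPne : P.Nonempty := by
    obtain ⟨z, ⟨hz, -⟩, rfl⟩ := huCV; exact ⟨z, hz, rfl⟩
  have hQne : Q.Nonempty := by
    obtain ⟨z, ⟨hz, -⟩, rfl⟩ := hvCV; exact ⟨z, hz, rfl⟩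
  have hPC : P ⊆ C := fun z hz => hz.1
  have hQC : Q ⊆ C := fun z hz => hz.1
  have hPu : ∀ p ∈ P, f p = u := fun p hp => hp.2
  have hQv : ∀ q ∈ Q, f q = v := fun q hq => hq.2
  -- a critical point with value in `[a₁, b₁]` lies on one of the two levels
  have hPQ : ∀ z ∈ C, f z ∈ Icc a₁ b₁ → z ∈ P ∪ Q := by
    intro z hz hzI
    have hzw : f z ∈ Ioo a b := hslab' hzI
    have hzCV : f z ∈ CV := ⟨z, ⟨hz, hzw⟩, rfl⟩
    by_cases hzu : f z = u
    · exact Or.inl ⟨hz, hzu⟩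
    by_cases hzv : f z = v
    · exact Or.inr ⟨hz, hzv⟩
    exfalso
    have h1 : v < f z := lt_of_le_of_ne (hgap _ hzCV hzu) (Ne.symm hzv)
    have h2 : b₀ ≤ f z := hRge _ ⟨z, hz, rfl⟩ h1
    linarith [hzI.2]
  have hPk : ∀ p ∈ P, morseIndex (𝓡∂ (n + 1)) f p = k := fun p hp =>
    hk p hp.1 (hp.2 ▸ hCVsub u huCV)
  have hQk : ∀ q ∈ Q, morseIndex (𝓡∂ (n + 1)) f q = k := fun q hq =>
    hk q hq.1 (hq.2 ▸ hCVsub v hvCV)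
  -- merge: Thms. 4.1–4.2 with 4.4 on the slab, `a' = b' = w`
  obtain ⟨g, hgM, hgcrit, hgidx, hgeq, hgP, hgQ⟩ :=
    Cobordism.Milnor1965_rearrange_consecutive_levels_holds hf ha₁0 ha₁u huv hvb₁ hb₁1 hPne hQne
      hPC hQC hPu hQv hPQ le_rfl hPk hQk hw₁ hw₁
  have hsame : c.SameCritical f g := ⟨hgM, hgcrit, hgidx⟩
  -- `g` keeps the small slab, hence the window
  have hgslab : ∀ z, f z ∈ Ioo a₁ b₁ → g z ∈ Ioo a₁ b₁ := by
    refine hf.apply_mem_Ioo_of_rearrangement hgM ha₁0 hb₁1 hgeq fun z hz hzI => ?_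
    rw [hgcrit] at hz
    rcases hPQ z hz (Ioo_subset_Icc_self hzI) with hzP | hzQ
    · rw [hgP z hzP]; exact hw₁
    · rw [hgQ z hzQ]; exact hw₁
  have hgoff : ∀ z, f z ∉ Ioo a b → g z = f z := fun z hz => hgeq z fun h => hz (hslab h)
  have hgwin : ∀ z, f z ∈ Ioo a b → g z ∈ Ioo a b := by
    intro z hz
    by_cases hzI : f z ∈ Ioo a₁ b₁
    · exact hslab (hgslab z hzI)
    · rw [hgeq z hzI]; exact hz
  refine ⟨g, hsame, hgoff, hgwin, ?_⟩
  -- the critical levels of `g` in the window: `w` and the old ones other than `u`, `v`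
  have hsub : g '' (criticalSet (𝓡∂ (n + 1)) g ∩ g ⁻¹' Ioo a b) ⊆ insert w (CV \ {u, v}) := by
    rintro t ⟨z, ⟨hz, hzt⟩, rfl⟩
    rw [hgcrit] at hz
    have hzt : g z ∈ Ioo a b := hzt
    have hfz : f z ∈ Ioo a b := by
      by_contra h
      rw [hgoff z h] at hzt
      exact h hzt
    by_cases hzI : f z ∈ Icc a₁ b₁
    · rcases hPQ z hz hzI with hzP | hzQ
      · exact Or.inl (hgP z hzP)
      · exact Or.inl (hgQ z hzQ)
    · have hzI' : f z ∉ Ioo a₁ b₁ := fun h => hzI (Ioo_subset_Icc_self h)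
      refine Or.inr ⟨⟨z, ⟨hz, hfz⟩, (hgeq z hzI').symm⟩, ?_⟩
      rw [hgeq z hzI']
      rintro (h | h)
      · exact hzI (h ▸ ⟨ha₁u.le, (huv.trans hvb₁).le⟩)
      · exact hzI (h ▸ ⟨(ha₁u.trans huv).le, hvb₁.le⟩)
  have hpair : ({u, v} : Set ℝ) ⊆ CV := by
    rintro t (rfl | rfl)
    · exact huCV
    · exact hvCV
  have hfin' : (insert w (CV \ {u, v})).Finite := hCVfin.sdiff.insert w
  calc (g '' (criticalSet (𝓡∂ (n + 1)) g ∩ g ⁻¹' Ioo a b)).ncard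
      ≤ (insert w (CV \ {u, v})).ncard := ncard_le_ncard hsub hfin'
    _ ≤ (CV \ {u, v}).ncard + 1 := ncard_insert_le w _
    _ = CV.ncard - ({u, v} : Set ℝ).ncard + 1 := by rw [ncard_sdiff hpair]
    _ = CV.ncard - 2 + 1 := by rw [ncard_pair huv.ne]
    _ < CV.ncard := by omega

/-- **All critical points of a one-index window on one level** (Milnor 1965, proof of Thm. 4.8,
PDF p. 25, run inside the window `f⁻¹(a, b)`).  Let `f` be a Morse function on the cobordism
`c` and `0 ≤ a < b ≤ 1` such that every critical point with value in `(a, b)` has index `k`.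
Then there is a Morse function `g` on `c` with the same critical points and indices, equal to
`f` off `f⁻¹(a, b)`, mapping `f⁻¹(a, b)` into `(a, b)` (so that `{g ≤ t} = {f ≤ t}` and
`g⁻¹(t) = f⁻¹(t)` for `t ∉ (a, b)`), and a level `v ∈ (a, b)` carrying every critical point of
the window.  Proof: induction on the number of critical levels in the window
(`exists_sameCritical_merge_window`). [cite: MilnorHCobordism1965, Thms. 4.1, 4.2, 4.4 and proof of Thm. 4.8 (PDF pp. 22–25)] -/
theorem exists_sameCritical_oneLevel_window {c : Cobordism n M N} {f : c.W → ℝ}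
    (hf : c.IsMorseFunction f) {a b : ℝ} (ha : 0 ≤ a) (hab : a < b) (hb : b ≤ 1) {k : ℕ}
    (hk : ∀ z ∈ criticalSet (𝓡∂ (n + 1)) f, f z ∈ Ioo a b → morseIndex (𝓡∂ (n + 1)) f z = k) :
    ∃ g : c.W → ℝ, c.SameCritical f g ∧ (∀ z, f z ∉ Ioo a b → g z = f z) ∧
      (∀ z, f z ∈ Ioo a b → g z ∈ Ioo a b) ∧
      ∃ v ∈ Ioo a b, ∀ z ∈ criticalSet (𝓡∂ (n + 1)) f, f z ∈ Ioo a b → g z = v := by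
  -- induction on the number `m` of critical levels in the window
  suffices H : ∀ (m : ℕ) {f : c.W → ℝ}, c.IsMorseFunction f →
      (∀ z ∈ criticalSet (𝓡∂ (n + 1)) f, f z ∈ Ioo a b → morseIndex (𝓡∂ (n + 1)) f z = k) →
      (f '' (criticalSet (𝓡∂ (n + 1)) f ∩ f ⁻¹' Ioo a b)).ncard ≤ m →
      ∃ g : c.W → ℝ, c.SameCritical f g ∧ (∀ z, f z ∉ Ioo a b → g z = f z) ∧
        (∀ z, f z ∈ Ioo a b → g z ∈ Ioo a b) ∧
        ∃ v ∈ Ioo a b, ∀ z ∈ criticalSet (𝓡∂ (n + 1)) f, f z ∈ Ioo a b → g z = v from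
    H _ hf hk le_rfl
  intro m
  induction m with
  | zero =>
    intro f hf hk hcard
    -- no critical level in the window: `g = f`
    have hfin : (f '' (criticalSet (𝓡∂ (n + 1)) f ∩ f ⁻¹' Ioo a b)).Finite :=
      (hf.finite_criticalSet.inter_of_left _).image f
    have hempty : f '' (criticalSet (𝓡∂ (n + 1)) f ∩ f ⁻¹' Ioo a b) = ∅ :=
      (ncard_eq_zero hfin).1 (Nat.le_zero.1 hcard)
    refine ⟨f, SameCritical.refl hf, fun _ _ => rfl, fun _ h => h, (a + b) / 2,
      ⟨by linarith, by linarith⟩, fun z hz hzw => ?_⟩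
    have : f z ∈ f '' (criticalSet (𝓡∂ (n + 1)) f ∩ f ⁻¹' Ioo a b) := ⟨z, ⟨hz, hzw⟩, rfl⟩
    rw [hempty] at this
    exact absurd this (notMem_empty _)
  | succ m ih =>
    intro f hf hk hcard
    by_cases hle : (f '' (criticalSet (𝓡∂ (n + 1)) f ∩ f ⁻¹' Ioo a b)).ncard ≤ 1
    · -- at most one critical level in the window: `g = f`
      have hfin : (f '' (criticalSet (𝓡∂ (n + 1)) f ∩ f ⁻¹' Ioo a b)).Finite :=
        (hf.finite_criticalSet.inter_of_left _).image f
      by_cases hne : (criticalSet (𝓡∂ (n + 1)) f ∩ f ⁻¹' Ioo a b).Nonempty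
      · obtain ⟨z₀, hz₀, hz₀w⟩ := hne
        refine ⟨f, SameCritical.refl hf, fun _ _ => rfl, fun _ h => h, f z₀, hz₀w,
          fun z hz hzw => ?_⟩
        exact (ncard_le_one_iff hfin).1 hle ⟨z, ⟨hz, hzw⟩, rfl⟩ ⟨z₀, ⟨hz₀, hz₀w⟩, rfl⟩
      · refine ⟨f, SameCritical.refl hf, fun _ _ => rfl, fun _ h => h, (a + b) / 2,
          ⟨by linarith, by linarith⟩, fun z hz hzw => ?_⟩
        exact absurd ⟨z, hz, hzw⟩ hne
    · -- at least two critical levels: merge the two lowest ones and recurse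
      obtain ⟨g₁, hg₁, hoff₁, hwin₁, hlt⟩ :=
        hf.exists_sameCritical_merge_window ha hb hk (by omega)
      have hg₁M : c.IsMorseFunction g₁ := hg₁.1
      have hcrit₁ : criticalSet (𝓡∂ (n + 1)) g₁ = criticalSet (𝓡∂ (n + 1)) f := hg₁.2.1
      -- for a critical point, being in the window is the same for `f` and `g₁`
      have hiff : ∀ z, g₁ z ∈ Ioo a b → f z ∈ Ioo a b := by
        intro z hz
        by_contra h
        rw [hoff₁ z h] at hz
        exact h hz
      have hk₁ : ∀ z ∈ criticalSet (𝓡∂ (n + 1)) g₁, g₁ z ∈ Ioo a b →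
          morseIndex (𝓡∂ (n + 1)) g₁ z = k := by
        intro z hz hzw
        rw [hcrit₁] at hz
        rw [hg₁.2.2 z hz]
        exact hk z hz (hiff z hzw)
      obtain ⟨g, hg, hoff, hwin, v, hv, hlevel⟩ := ih hg₁M hk₁ (by omega)
      refine ⟨g, hg₁.trans hg, fun z hz => ?_, fun z hz => hwin z (hwin₁ z hz), v, hv,
        fun z hz hzw => ?_⟩
      · have h1 : g₁ z = f z := hoff₁ z hz
        rw [hoff z (by rwa [h1]), h1]
      · exact hlevel z (by rwa [hcrit₁]) (hwin₁ z hzw)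

/-! ### Two-three Morse functions: one level of index-2 points, one level of index-3 points -/

/-- **Normal form of a two-three Morse function near the middle level.**  Let `f` be a Morse
function on the cobordism `c` every critical point of which has index `2` and value `< 1/2`
or index `3` and value `> 1/2` (the hypothesis of rung (B),
`Literature.Topology.FourManifolds.exists_dualSpheres_middleLevel_of_two_three`).  Then there
are a Morse function `g` on `c` with the same critical points and indices, still two-three,
levels `0 < v₂ < 1/2 < v₃ < 1` such that every index-`2` critical point lies on the level
`v₂` and every index-`3` critical point on the level `v₃`, and a `δ > 0` such that `g = f` on
the neighbourhood `f⁻¹(1/2 - δ, 1/2 + δ)` of the middle level (in particular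
`g⁻¹(1/2) = f⁻¹(1/2)`).  This is Milnor's Thm. 4.8 (PDF p. 25) run separately below and above
the middle level (`exists_sameCritical_oneLevel_window` on the windows `(0, 1/2 - δ)` and
`(1/2 + δ, 1)`), as in the first sentences of the printed proofs of the cork theorem (Kirby
1996, §2; Matveyev 1996, p. 1) and in Milnor's §3, p. 21 (several critical points on one
level). [cite: MilnorHCobordism1965, Thm. 4.8 and its proof (PDF p. 25)] [cite: KirbyCorks1996, §2] -/
theorem exists_two_three_oneLevel {c : Cobordism n M N} {f : c.W → ℝ} (hf : c.IsMorseFunction f)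
    (h23 : ∀ z, IsMCriticalPt (𝓡∂ (n + 1)) f z →
      morseIndex (𝓡∂ (n + 1)) f z = 2 ∧ f z < 2⁻¹ ∨ morseIndex (𝓡∂ (n + 1)) f z = 3 ∧ 2⁻¹ < f z) :
    ∃ (g : c.W → ℝ) (v₂ v₃ δ : ℝ), c.SameCritical f g ∧
      (∀ z, IsMCriticalPt (𝓡∂ (n + 1)) g z →
        morseIndex (𝓡∂ (n + 1)) g z = 2 ∧ g z < 2⁻¹ ∨ morseIndex (𝓡∂ (n + 1)) g z = 3 ∧ 2⁻¹ < g z) ∧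
      0 < v₂ ∧ v₂ < 2⁻¹ ∧ 2⁻¹ < v₃ ∧ v₃ < 1 ∧
      (∀ z ∈ criticalSet (𝓡∂ (n + 1)) f, morseIndex (𝓡∂ (n + 1)) f z = 2 → g z = v₂) ∧
      (∀ z ∈ criticalSet (𝓡∂ (n + 1)) f, morseIndex (𝓡∂ (n + 1)) f z = 3 → g z = v₃) ∧
      0 < δ ∧ (∀ z, f z ∈ Ioo (2⁻¹ - δ) (2⁻¹ + δ) → g z = f z) ∧
      (∀ z, g z ∈ Ioo (2⁻¹ - δ) (2⁻¹ + δ) ↔ f z ∈ Ioo (2⁻¹ - δ) (2⁻¹ + δ)) := by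
  classical
  -- a margin `δ` around `1/2` free of critical values
  have hCfin : (criticalSet (𝓡∂ (n + 1)) f).Finite := hf.finite_criticalSet
  set D : Set ℝ := insert 4⁻¹ ((fun z => |f z - 2⁻¹|) '' criticalSet (𝓡∂ (n + 1)) f) with hD
  have hDfin : D.Finite := (hCfin.image _).insert _
  obtain ⟨δ₀, hδ₀D, hδ₀⟩ := D.exists_min_image id hDfin ⟨4⁻¹, mem_insert _ _⟩
  have hδ₀pos : 0 < δ₀ := by
    rcases hδ₀D with rfl | ⟨z, hz, rfl⟩
    · norm_num
    · rcases h23 z (mem_criticalSet.1 hz) with ⟨-, h⟩ | ⟨-, h⟩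
      · exact abs_pos.2 (sub_ne_zero.2 h.ne)
      · exact abs_pos.2 (sub_ne_zero.2 h.ne')
  have hδ₀le : δ₀ ≤ 4⁻¹ := hδ₀ _ (mem_insert _ _)
  have hδ₀crit : ∀ z ∈ criticalSet (𝓡∂ (n + 1)) f, δ₀ ≤ |f z - 2⁻¹| := fun z hz =>
    hδ₀ _ (mem_insert_of_mem _ ⟨z, hz, rfl⟩)
  set δ := δ₀ / 2 with hδ
  have hδpos : 0 < δ := by rw [hδ]; linarith
  have hδlt : δ < δ₀ := by rw [hδ]; linarith
  have hδ4 : δ < 4⁻¹ := hδlt.trans_le hδ₀le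
  -- critical values avoid `[1/2 - δ, 1/2 + δ]`
  have hcrit2 : ∀ z ∈ criticalSet (𝓡∂ (n + 1)) f, morseIndex (𝓡∂ (n + 1)) f z = 2 →
      f z ∈ Ioo (0 : ℝ) (2⁻¹ - δ) := by
    intro z hz hidx
    have hval := (SameCritical.refl hf).apply_mem_Ioo hz
    rcases h23 z (mem_criticalSet.1 hz) with ⟨-, h⟩ | ⟨h, -⟩
    · refine ⟨hval.1, ?_⟩
      have := hδ₀crit z hz
      rw [abs_of_neg (by linarith)] at this
      linarith
    · omega
  have hcrit3 : ∀ z ∈ criticalSet (𝓡∂ (n + 1)) f, morseIndex (𝓡∂ (n + 1)) f z = 3 →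
      f z ∈ Ioo (2⁻¹ + δ) (1 : ℝ) := by
    intro z hz hidx
    have hval := (SameCritical.refl hf).apply_mem_Ioo hz
    rcases h23 z (mem_criticalSet.1 hz) with ⟨h, -⟩ | ⟨-, h⟩
    · omega
    · refine ⟨?_, hval.2⟩
      have := hδ₀crit z hz
      rw [abs_of_pos (by linarith)] at this
      linarith
  have hidx23 : ∀ z ∈ criticalSet (𝓡∂ (n + 1)) f,
      morseIndex (𝓡∂ (n + 1)) f z = 2 ∨ morseIndex (𝓡∂ (n + 1)) f z = 3 := fun z hz => by
    rcases h23 z (mem_criticalSet.1 hz) with ⟨h, -⟩ | ⟨h, -⟩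
    · exact Or.inl h
    · exact Or.inr h
  -- Step 1: the upper window `(1/2 + δ, 1)`, index 3
  have hk3 : ∀ z ∈ criticalSet (𝓡∂ (n + 1)) f, f z ∈ Ioo (2⁻¹ + δ) 1 →
      morseIndex (𝓡∂ (n + 1)) f z = 3 := by
    intro z hz hzw
    rcases hidx23 z hz with h | h
    · have := (hcrit2 z hz h).2; linarith [hzw.1]
    · exact h
  obtain ⟨g₁, hg₁, hoff₁, hwin₁, v₃, hv₃, hlev₁⟩ :=
    hf.exists_sameCritical_oneLevel_window (a := 2⁻¹ + δ) (b := 1) (by linarith) (by linarith)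
      le_rfl hk3
  have hcrit₁ : criticalSet (𝓡∂ (n + 1)) g₁ = criticalSet (𝓡∂ (n + 1)) f := hg₁.2.1
  -- values of `g₁`: unchanged below `1/2 + δ`
  have hg₁low : ∀ z, f z ≤ 2⁻¹ + δ → g₁ z = f z := fun z hz => hoff₁ z fun h => by linarith [h.1]
  -- Step 2: the lower window `(0, 1/2 - δ)`, index 2, applied to `g₁`
  have hk2 : ∀ z ∈ criticalSet (𝓡∂ (n + 1)) g₁, g₁ z ∈ Ioo 0 (2⁻¹ - δ) →
      morseIndex (𝓡∂ (n + 1)) g₁ z = 2 := by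
    intro z hz hzw
    rw [hcrit₁] at hz
    rw [hg₁.2.2 z hz]
    rcases hidx23 z hz with h | h
    · exact h
    · exfalso
      have h3 := hcrit3 z hz h
      have := (hwin₁ z h3).1
      linarith [hzw.2]
  obtain ⟨g, hg, hoff, hwin, v₂, hv₂, hlev⟩ :=
    hg₁.1.exists_sameCritical_oneLevel_window (a := 0) (b := 2⁻¹ - δ) le_rfl (by linarith)
      (by linarith) hk2
  have hcrit : criticalSet (𝓡∂ (n + 1)) g = criticalSet (𝓡∂ (n + 1)) f := hg.2.1.trans hcrit₁
  -- bookkeeping of values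
  have hval2 : ∀ z ∈ criticalSet (𝓡∂ (n + 1)) f, morseIndex (𝓡∂ (n + 1)) f z = 2 → g z = v₂ := by
    intro z hz hidx
    have h2 := hcrit2 z hz hidx
    have e1 : g₁ z = f z := hg₁low z (by linarith [h2.2])
    exact hlev z (by rwa [hcrit₁]) (by rw [e1]; exact h2)
  have hval3 : ∀ z ∈ criticalSet (𝓡∂ (n + 1)) f, morseIndex (𝓡∂ (n + 1)) f z = 3 → g z = v₃ := by
    intro z hz hidx
    have h3 := hcrit3 z hz hidx
    have e1 : g₁ z = v₃ := hlev₁ z hz h3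
    have : g₁ z ∉ Ioo 0 (2⁻¹ - δ) := fun h => by rw [e1] at h; linarith [h.2, hv₃.1]
    rw [hoff z this, e1]
  have hmid : ∀ z, f z ∈ Ioo (2⁻¹ - δ) (2⁻¹ + δ) → g z = f z := by
    intro z hz
    have e1 : g₁ z = f z := hg₁low z hz.2.le
    have : g₁ z ∉ Ioo 0 (2⁻¹ - δ) := fun h => by rw [e1] at h; linarith [h.2, hz.1]
    rw [hoff z this, e1]
  -- where `g` differs from `f`, both values lie on the same side, outside the margin
  have hside : ∀ z, (f z ∈ Ioo (2⁻¹ + δ) 1 → g z ∈ Ioo (2⁻¹ + δ) 1) ∧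
      (f z ∈ Ioo 0 (2⁻¹ - δ) → g z ∈ Ioo 0 (2⁻¹ - δ)) := by
    intro z
    constructor
    · intro hz
      have h1 := hwin₁ z hz
      have : g₁ z ∉ Ioo 0 (2⁻¹ - δ) := fun h => by linarith [h.2, h1.1]
      rw [hoff z this]; exact h1
    · intro hz
      have e1 : g₁ z = f z := hg₁low z (by linarith [hz.2])
      exact hwin z (by rw [e1]; exact hz)
  have hmid_iff : ∀ z, g z ∈ Ioo (2⁻¹ - δ) (2⁻¹ + δ) ↔ f z ∈ Ioo (2⁻¹ - δ) (2⁻¹ + δ) := by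
    intro z
    refine ⟨fun hz => ?_, fun hz => by rwa [hmid z hz]⟩
    by_contra hfz
    -- then `f z ≤ 1/2 - δ` or `f z ≥ 1/2 + δ`
    by_cases hup : f z ∈ Ioo (2⁻¹ + δ) 1
    · have := ((hside z).1 hup).1; linarith [hz.2]
    by_cases hdown : f z ∈ Ioo 0 (2⁻¹ - δ)
    · have := ((hside z).2 hdown).2; linarith [hz.1]
    -- otherwise `g z = f z`
    have e1 : g₁ z = f z := hoff₁ z hup
    have e2 : g z = g₁ z := hoff z (by rwa [e1])
    rw [e2, e1] at hz
    exact hfz hz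
  refine ⟨g, v₂, v₃, δ, hg₁.trans hg, fun z hz => ?_, hv₂.1, by linarith [hv₂.2], by linarith [hv₃.1],
    hv₃.2, hval2, hval3, hδpos, hmid, hmid_iff⟩
  -- `g` is two-three
  have hz' : z ∈ criticalSet (𝓡∂ (n + 1)) f := by rw [← hcrit]; exact mem_criticalSet.2 hz
  have hidx : morseIndex (𝓡∂ (n + 1)) g z = morseIndex (𝓡∂ (n + 1)) f z :=
    (hg₁.trans hg).2.2 z hz'
  rcases hidx23 z hz' with h | h
  · left
    refine ⟨hidx.trans h, ?_⟩
    rw [hval2 z hz' h]; linarith [hv₂.2]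
  · right
    refine ⟨hidx.trans h, ?_⟩
    rw [hval3 z hz' h]; linarith [hv₃.1]

end OneLevel

end Cobordism.IsMorseFunction

/-! ### The middle level of a two-three handlebody of an h-cobordism of simply connected 4-manifolds -/

section MiddleLevel

variable {X₁ X₂ : Type u} [TopologicalSpace X₁] [T2Space X₁] [SecondCountableTopology X₁]
  [ChartedSpace (EuclideanSpace ℝ (Fin 4)) X₁] [IsManifold (𝓡 4) ∞ X₁] [CompactSpace X₁]
  [SimplyConnectedSpace X₁]
  [TopologicalSpace X₂] [T2Space X₂] [SecondCountableTopology X₂]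
  [ChartedSpace (EuclideanSpace ℝ (Fin 4)) X₂] [IsManifold (𝓡 4) ∞ X₂] [CompactSpace X₂]

/-- **The middle level of a two-three handlebody is simply connected** (Kirby 1996, §2:
*"Note that `M_{1/2}` is 1-connected (5-manifolds with only 3, 4 and 5-handles are
1-connected)"*; Milnor 1965, Remark 1 after Thm. 6.4, PDF p. 38: *"`V = f⁻¹(1/2)` is also
simply connected"*).  For an h-cobordism `c` from a simply connected closed 4-manifold and a
Morse function `f` on it whose critical points have index `2` and value `< 1/2` or index `3`
and value `> 1/2`, the level `f⁻¹(1/2)` is simply connected: `W` is simply connected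
(`Cobordism.IsHCobordism.simplyConnectedSpace`) and clause (1) of
`Cobordism.Milnor1965_simplyConnected_levels_holds` applies (below `1/2` only index `2`,
`2 ≤ 2`, `2 + 3 ≤ 5`). [cite: KirbyCorks1996, §2] [cite: MilnorHCobordism1965, Remark 1 after Thm. 6.4 (PDF p. 38)] -/
theorem Cobordism.IsHCobordism.simplyConnectedSpace_middleLevel_of_two_three {c : Cobordism 4 X₁ X₂}
    (hc : c.IsHCobordism) {f : c.W → ℝ} (hf : c.IsMorseFunction f)
    (h23 : ∀ z, IsMCriticalPt (𝓡∂ (4 + 1)) f z →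
      morseIndex (𝓡∂ (4 + 1)) f z = 2 ∧ f z < 2⁻¹ ∨ morseIndex (𝓡∂ (4 + 1)) f z = 3 ∧ 2⁻¹ < f z) :
    SimplyConnectedSpace ↥(f ⁻¹' {2⁻¹}) := by
  have hW : SimplyConnectedSpace c.W := hc.simplyConnectedSpace
  have hreg : ∀ z ∈ criticalSet (𝓡∂ (4 + 1)) f, f z ≠ 2⁻¹ := fun z hz heq =>
    not_isMCriticalPt_of_apply_eq h23 heq (mem_criticalSet.1 hz)
  refine (Cobordism.Milnor1965_simplyConnected_levels_holds hc hW hf (b := 2⁻¹)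
    ⟨by norm_num, by norm_num⟩ hreg).1 fun z hz hlt => ?_
  rcases h23 z (mem_criticalSet.1 hz) with ⟨h, -⟩ | ⟨-, h⟩
  · rw [h]
    exact ⟨le_rfl, by norm_num⟩
  · exact absurd hlt (not_lt.2 h.le)

/-- **The middle level of a two-three handlebody is a closed, simply connected, oriented
smooth 4-manifold** — the datum `N`, `oN`, `ι` of rung (B)
`Literature.Topology.FourManifolds.exists_dualSpheres_middleLevel_of_two_three` (Matveyev 1996,
p. 1: *"Let `N` be the middle level of `U` between 2- and 3-handles"*; Kirby 1996, §2).  For an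
h-cobordism `c` from a simply connected closed 4-manifold `X₁` to a closed 4-manifold `X₂`
and a two-three Morse function `f` on it, there are a compact simply connected smooth
4-manifold `L` without boundary, an orientation of `L`, and a smooth embedding `ι : L → W`
with image `f⁻¹(1/2)`: `L` is the regular level `RegularLevel` of the regular value `1/2`
(`Cobordism.IsMorseFunction.isRegularLevel`, Hirsch Ch. 1 §3–4), simply connected by
`Cobordism.IsHCobordism.simplyConnectedSpace_middleLevel_of_two_three`, and orientable as every
simply connected manifold (`isOrientable_of_simplyConnectedSpace_holds`; Milnor's proof of
Cor. 6.5, PDF p. 38: *"simply connected hence orientable"*).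
[cite: Matveyev1996, Proof of Theorem, sentence 2 (arXiv p. 1)] [cite: KirbyCorks1996, §2]
[cite: MilnorHCobordism1965, Remark 1 after Thm. 6.4 and proof of Cor. 6.5 (PDF p. 38)] -/
theorem Cobordism.IsHCobordism.exists_oriented_middleLevel_of_two_three {c : Cobordism 4 X₁ X₂}
    (hc : c.IsHCobordism) {f : c.W → ℝ} (hf : c.IsMorseFunction f)
    (h23 : ∀ z, IsMCriticalPt (𝓡∂ (4 + 1)) f z →
      morseIndex (𝓡∂ (4 + 1)) f z = 2 ∧ f z < 2⁻¹ ∨ morseIndex (𝓡∂ (4 + 1)) f z = 3 ∧ 2⁻¹ < f z) :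
    ∃ (L : Type u) (_ : TopologicalSpace L) (_ : T2Space L) (_ : SecondCountableTopology L)
      (_ : ChartedSpace (EuclideanSpace ℝ (Fin 4)) L) (_ : IsManifold (𝓡 4) ∞ L)
      (_ : CompactSpace L) (_ : SimplyConnectedSpace L) (_ : SmoothOrientation (𝓡 4) L)
      (ι : L → c.W), Manifold.IsSmoothEmbedding (𝓡 4) (𝓡∂ (4 + 1)) ∞ ι ∧ range ι = f ⁻¹' {2⁻¹} := by
  have hreg : ∀ z, IsMCriticalPt (𝓡∂ (4 + 1)) f z → f z ≠ 2⁻¹ := fun z hz heq =>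
    not_isMCriticalPt_of_apply_eq h23 heq hz
  have hlev : IsRegularLevel (𝓡∂ (4 + 1)) f 2⁻¹ := hf.isRegularLevel ⟨by norm_num, by norm_num⟩ hreg
  have hsc : SimplyConnectedSpace (RegularLevel hlev) :=
    hc.simplyConnectedSpace_middleLevel_of_two_three hf h23
  obtain ⟨oL⟩ := isOrientable_of_simplyConnectedSpace_holds (I := 𝓡 4) (M := RegularLevel hlev)
  exact ⟨RegularLevel hlev, inferInstance, inferInstance, inferInstance, inferInstance,
    inferInstance, inferInstance, hsc, oL, RegularLevel.incl hlev,
    RegularLevel.isSmoothEmbedding_incl hlev, RegularLevel.range_incl hlev⟩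

/-- **The normalised middle-level datum of rung (B)**: for an h-cobordism `c` from a simply
connected closed 4-manifold and a two-three Morse function `f` on it, there are a two-three
Morse function `g` with the same critical points and indices, all index-`2` points on one
level `v₂ < 1/2` and all index-`3` points on one level `v₃ > 1/2`, agreeing with `f` on a
neighbourhood `f⁻¹(1/2 - δ, 1/2 + δ)` of the middle level
(`Cobordism.IsMorseFunction.exists_two_three_oneLevel`), together with the presentation of the
common middle level `g⁻¹(1/2) = f⁻¹(1/2)` by a closed simply connected oriented 4-manifold
(`Cobordism.IsHCobordism.exists_oriented_middleLevel_of_two_three`).  This is the state reached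
after the first two sentences of Matveyev's proof (p. 1) and Kirby's §2, with Milnor's §3
p. 21 / Thm. 4.8 normalisation that the surgery description of the ends (Thm. 3.13) starts
from. [cite: Matveyev1996, Proof of Theorem, sentences 1–2 (arXiv p. 1)] [cite: KirbyCorks1996, §2]
[cite: MilnorHCobordism1965, §3 p. 21 and Thm. 4.8 (PDF pp. 21, 25)] -/
theorem Cobordism.IsHCobordism.exists_two_three_oneLevel_middleLevel {c : Cobordism 4 X₁ X₂}
    (hc : c.IsHCobordism) {f : c.W → ℝ} (hf : c.IsMorseFunction f)
    (h23 : ∀ z, IsMCriticalPt (𝓡∂ (4 + 1)) f z →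
      morseIndex (𝓡∂ (4 + 1)) f z = 2 ∧ f z < 2⁻¹ ∨ morseIndex (𝓡∂ (4 + 1)) f z = 3 ∧ 2⁻¹ < f z) :
    ∃ (g : c.W → ℝ) (v₂ v₃ δ : ℝ), c.SameCritical f g ∧
      (∀ z, IsMCriticalPt (𝓡∂ (4 + 1)) g z →
        morseIndex (𝓡∂ (4 + 1)) g z = 2 ∧ g z < 2⁻¹ ∨ morseIndex (𝓡∂ (4 + 1)) g z = 3 ∧ 2⁻¹ < g z) ∧
      0 < v₂ ∧ v₂ < 2⁻¹ ∧ 2⁻¹ < v₃ ∧ v₃ < 1 ∧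
      (∀ z ∈ criticalSet (𝓡∂ (4 + 1)) f, morseIndex (𝓡∂ (4 + 1)) f z = 2 → g z = v₂) ∧
      (∀ z ∈ criticalSet (𝓡∂ (4 + 1)) f, morseIndex (𝓡∂ (4 + 1)) f z = 3 → g z = v₃) ∧
      0 < δ ∧ (∀ z, f z ∈ Ioo (2⁻¹ - δ) (2⁻¹ + δ) → g z = f z) ∧ g ⁻¹' {2⁻¹} = f ⁻¹' {2⁻¹} ∧
      ∃ (L : Type u) (_ : TopologicalSpace L) (_ : T2Space L) (_ : SecondCountableTopology L)
        (_ : ChartedSpace (EuclideanSpace ℝ (Fin 4)) L) (_ : IsManifold (𝓡 4) ∞ L)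
        (_ : CompactSpace L) (_ : SimplyConnectedSpace L) (_ : SmoothOrientation (𝓡 4) L)
        (ι : L → c.W), Manifold.IsSmoothEmbedding (𝓡 4) (𝓡∂ (4 + 1)) ∞ ι ∧
          range ι = g ⁻¹' {2⁻¹} := by
  obtain ⟨g, v₂, v₃, δ, hsame, hg23, h0, h1, h2, h3, hval2, hval3, hδ, hmid, hmid_iff⟩ :=
    hf.exists_two_three_oneLevel h23
  have hlevel : g ⁻¹' {2⁻¹} = f ⁻¹' {2⁻¹} := by
    ext z
    simp only [mem_preimage, mem_singleton_iff]
    constructor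
    · intro hz
      have hzI : g z ∈ Ioo (2⁻¹ - δ) (2⁻¹ + δ) := by rw [hz]; exact ⟨by linarith, by linarith⟩
      rw [← hmid z ((hmid_iff z).1 hzI), hz]
    · intro hz
      rw [hmid z (by rw [hz]; exact ⟨by linarith, by linarith⟩), hz]
  obtain ⟨L, _, _, _, _, _, _, hL, oL, ι, hι, hrange⟩ :=
    hc.exists_oriented_middleLevel_of_two_three hsame.1 hg23
  exact ⟨g, v₂, v₃, δ, hsame, hg23, h0, h1, h2, h3, hval2, hval3, hδ, hmid, hlevel,
    L, ‹_›, ‹_›, ‹_›, ‹_›, ‹_›, ‹_›, hL, oL, ι, hι, hrange⟩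

end MiddleLevel

end Literature.Topology.FourManifolds
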